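/-
Copyright (c) 2026 the pub-hodgecm-mathlib formalisation cell (harness21).  Prover seat hodgecm-mathlib-LH4-p04 (g8), req620 Track A «(D-RAM) FOUR-FRAME» squad
(STAGE-1b, row (2), the (β₂) road; heir LEAD F0P3a-plan (g21) T20-18∕19∕20 (R-36) «PURE-CELL LEDGER, RELATIVE SIGNS»; β₂-BOARD v1.1 row (L-Σ), brick (L-Σ-0): the arithmetic shell), 2026-09-04.
-/
import Mathlib.Algebra.BigOperators.Ring.Finset
import Mathlib.Algebra.Order.BigOperators.Group.Finset
import Mathlib.Data.Finset.Prod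
import Mathlib.Algebra.BigOperators.Intervals
import HarnessLib

/-!
# Crux `H413`, line LH4 «(D-RAM) FOUR-FRAME» — STAGE-1b, row (2), the (β₂) road, β₂-BOARD row (L-Σ), brick (L-Σ-0): «THE CELL-SUM ARITHMETIC SHELL» —
# `cellSum = Σ over the finite cell box`, `= Σ over any list off which the summand vanishes`, and the LEDGER PRINCIPLE `cellSum_A = cellSum_H` from (L-P) + a list identity

Cell `hodgecm-mathlib` (D-0151), FLOOR 0, crux item H413 = `stmt-HodgeConjecture-24833`, route of record `HCCMUnconditional`; squad F0∕P3c∕LH4; lane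
`--supports stmt-HodgeConjecture-24833 --as helper` (count-neutral; pays NO tier-0 row).  THEOREMS ONLY (no `def`, no instance, no notation, no `sorry`, default heartbeats).
PURE FINSET ALGEBRA over `ℤ` — no field, no lattice: the summands are abstract functions `a₀ : ℕ → ℤ` (axis cells `(j, 0)`) and `a : ℕ → ℕ → ℤ` (cone cells `(j, b)`, `b ≥ 1`)
behind an abstract level predicate `P j` (the socket's `IsOrd ρ α (jE ϖ ^ j) lam`).

WHY.  ★ p861441 `hbeta2Models_of_cells` reduced (β₂) to ONE letter `beta2Cells.letter.v1` (c9553f20): `cellSum_HYP = cellSum_ANISO`, each side of the SHAPE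
`(Σ_{j<J+1} [P j]·a₀ j) + Σ_{b∈[1,R]} Σ_{j<J+1} [P j]·a j b`.  Road (R-36) pays it by a PURE-CELL LEDGER: (L-P) «every cell off a short list S_t has summand 0» and a LIST IDENTITY
`Σ_{S_ANISO} = Σ_{S_HYP}` assembled from the relative rows (L-D×), (L-S1), (L-T), (L-K) (heir LEAD T20-19∕20).  THIS FILE is the arithmetic shell of that assembly, typed once:
* §1 `cellSum_eq_sum_box` — the socket's shape `=` ONE sum over the cell box `range (J+1) ×ˢ range (R+1)` of the summand `g (j, b) := [P j]·(b = 0 ? a₀ j : a j b)`;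
* §2 `sum_box_eq_sum_of_eq_zero_off` — if `g` vanishes on the box off a list `S ⊆ box`, the box sum is the sum over `S` (★ `Finset.sum_subset`);
* §3 HEAD `cellSum_eq_cellSum_of_ledger` — (L-Σ) PRINCIPLE: two shapes (`(a₀, a, R)` and `(h₀, h, R′)`, common `P`, `J`), two lists `S_A ⊆ box_R`, `S_H ⊆ box_{R′}`, (L-P) off the lists,
  and the list identity ⟹ `cellSum_A = cellSum_H`.  Consumers: the (L-Σ) assembly at the CM place (this seat) instantiates `a₀, a` with ★ p861305 §3's `cellDiff` summands.
HONEST LABEL.  Arithmetic only; nothing printed is asserted; no census value is stated; (β₂) ∕ `beta2Cells` stay HYPOTHESES; `HC_CM` is proved only modulo the 7 printed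
citations (2 remaining named inputs: hLiu418 = `stmt-HodgeConjecture-24832`, h413 = `stmt-HodgeConjecture-24833`) until rung 0 closes.
## References
* [Kottwitz1986BaseChangeUnits] R. E. Kottwitz, *Base change for unit elements of Hecke algebras*, Compositio Math. 60 (1986), §1 pp. 240–241 (the lattice-count bookkeeping).
* [Rogawski1990] J. D. Rogawski, *Automorphic Representations of Unitary Groups in Three Variables*, Ann. of Math. Stud. 123 (1990), §4.9 Prop. 4.9.1 (b) p. 55.
-/

set_option autoImplicit false

namespace Summit.HodgeConjecture.HodgeConjecture.Cruxes.H413.F0P3cDyRamCellSumArithmetic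

open Finset

/-! ## §1 The socket's shape as one sum over the cell box -/

/-- **THE CELL-SUM SHAPE IS A BOX SUM.**  `(Σ_{j<J+1} [P j]·a₀ j) + Σ_{b∈[1,R]} Σ_{j<J+1} [P j]·a j b = Σ_{(j,b) ∈ range(J+1) × range(R+1)} g (j,b)` with
`g (j,b) = if P j then (if b = 0 then a₀ j else a j b) else 0` (axis cells are the `b = 0` column). [cite: Kottwitz1986BaseChangeUnits, §1 pp. 240–241] -/
theorem cellSum_eq_sum_box (P : ℕ → Prop) [DecidablePred P] (a₀ : ℕ → ℤ) (a : ℕ → ℕ → ℤ) (J R : ℕ) :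
    (∑ j ∈ range (J + 1), (if P j then a₀ j else 0)) + ∑ b ∈ Icc 1 R, ∑ j ∈ range (J + 1), (if P j then a j b else 0) =
      ∑ p ∈ range (J + 1) ×ˢ range (R + 1), (if P p.1 then (if p.2 = 0 then a₀ p.1 else a p.1 p.2) else 0) := by
  rw [sum_product_right]
  conv_rhs => rw [sum_range_succ']
  have e1 : (∑ j ∈ range (J + 1), (if P j then a₀ j else 0)) =
      ∑ j ∈ range (J + 1), (if P ((j, 0) : ℕ × ℕ).1 then (if ((j, 0) : ℕ × ℕ).2 = 0 then a₀ ((j, 0) : ℕ × ℕ).1 else a ((j, 0) : ℕ × ℕ).1 ((j, 0) : ℕ × ℕ).2) else 0) :=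
    sum_congr rfl fun j _ => by simp
  have e2 : ∑ b ∈ Icc 1 R, ∑ j ∈ range (J + 1), (if P j then a j b else 0) =
      ∑ b ∈ range R, ∑ j ∈ range (J + 1),
        (if P ((j, b + 1) : ℕ × ℕ).1 then (if ((j, b + 1) : ℕ × ℕ).2 = 0 then a₀ ((j, b + 1) : ℕ × ℕ).1 else a ((j, b + 1) : ℕ × ℕ).1 ((j, b + 1) : ℕ × ℕ).2) else 0) := by
    rw [← Finset.Ico_add_one_right_eq_Icc, sum_Ico_eq_sum_range, Nat.add_sub_cancel]
    refine sum_congr rfl fun b _ => sum_congr rfl fun j _ => ?_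
    simp [Nat.add_comm 1 b]
  rw [e1, e2, add_comm]

/-! ## §2 A box sum is the sum over any list off which the summand vanishes -/

/-- **OFF-LIST VANISHING ((L-P)'s shape) COLLAPSES THE BOX SUM TO THE LIST.**  If `S ⊆ box` and `g = 0` on `box ∖ S` then `Σ_box g = Σ_S g` (★ `Finset.sum_subset`).
[cite: Kottwitz1986BaseChangeUnits, §1 pp. 240–241] -/
theorem sum_box_eq_sum_of_eq_zero_off {box S : Finset (ℕ × ℕ)} (hS : S ⊆ box) (g : ℕ × ℕ → ℤ) (h0 : ∀ p ∈ box, p ∉ S → g p = 0) :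
    ∑ p ∈ box, g p = ∑ p ∈ S, g p :=
  (sum_subset hS h0).symm

/-! ## §3 HEAD — the (L-Σ) principle -/

/-- **(L-Σ) PRINCIPLE — `cellSum_A = cellSum_H` FROM (L-P) AND A LIST IDENTITY.**  Two cell-sum shapes with common level predicate `P` and level range `J`: `(a₀, a)` up to tube
depth `R` and `(h₀, h)` up to `R′`; two lists `S_A ⊆ range(J+1) × range(R+1)`, `S_H ⊆ range(J+1) × range(R′+1)` (the PURE cells); (L-P): every listed-off cell of the box has
summand `0`; and the LEDGER identity `Σ_{S_A} g_A = Σ_{S_H} g_H` (assembled by the consumer from the relative rows (L-D×)(L-S1)(L-T)(L-K), heir LEAD T20-19∕20).  THEN the two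
cell sums agree — the shape of `beta2Cells.letter.v1`'s conclusion with `P j := IsOrd ρ α (jE ϖ^j) lam`, `a₀∕a := cellDiff_ANISO`, `h₀∕h := cellDiff_HYP` (or the other way round).
[cite: Kottwitz1986BaseChangeUnits, §1 pp. 240–241] [cite: Rogawski1990, §4.9 Prop. 4.9.1 (b) p. 55] -/
theorem cellSum_eq_cellSum_of_ledger (P : ℕ → Prop) [DecidablePred P] (a₀ h₀ : ℕ → ℤ) (a h : ℕ → ℕ → ℤ) (J R R' : ℕ)
    (SA SH : Finset (ℕ × ℕ)) (hSA : SA ⊆ range (J + 1) ×ˢ range (R + 1)) (hSH : SH ⊆ range (J + 1) ×ˢ range (R' + 1))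
    (hPA : ∀ p ∈ range (J + 1) ×ˢ range (R + 1), p ∉ SA → (if P p.1 then (if p.2 = 0 then a₀ p.1 else a p.1 p.2) else 0) = 0)
    (hPH : ∀ p ∈ range (J + 1) ×ˢ range (R' + 1), p ∉ SH → (if P p.1 then (if p.2 = 0 then h₀ p.1 else h p.1 p.2) else 0) = 0)
    (hL : ∑ p ∈ SA, (if P p.1 then (if p.2 = 0 then a₀ p.1 else a p.1 p.2) else 0) =
      ∑ p ∈ SH, (if P p.1 then (if p.2 = 0 then h₀ p.1 else h p.1 p.2) else 0)) :
    (∑ j ∈ range (J + 1), (if P j then a₀ j else 0)) + ∑ b ∈ Icc 1 R, ∑ j ∈ range (J + 1), (if P j then a j b else 0) =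
      (∑ j ∈ range (J + 1), (if P j then h₀ j else 0)) + ∑ b ∈ Icc 1 R', ∑ j ∈ range (J + 1), (if P j then h j b else 0) := by
  rw [cellSum_eq_sum_box P a₀ a J R, cellSum_eq_sum_box P h₀ h J R',
    sum_box_eq_sum_of_eq_zero_off hSA _ hPA, sum_box_eq_sum_of_eq_zero_off hSH _ hPH, hL]

end Summit.HodgeConjecture.HodgeConjecture.Cruxes.H413.F0P3cDyRamCellSumArithmetic
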